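import Literature.Geometry.DiscreteGeometry.EnergyLinearProgrammingBound

/-!
# Newton-form LP certificates for the energy of `(1 + ⟨x,y⟩)^k`: the Cohn–Kumar conductivity
argument made finite (all `k` at once)

Framing: lottery ticket; floor = certified bounds/negative ranges. Venture `PackingBounds` (cell
`pub-packcert`, seat `pub-packcert-energy`), energy-minimisation family, **universal optimality
infrastructure** (used by the per-configuration files `UniversalOptimality*.lean`).

Fix a dimension `n = 2μ + 2 ≥ 3` and a finite sequence of *node values* `v_0, …, v_{D-1} ≥ 0` in the
variable `u = 1 + t` (`t` the inner product; for a sharp configuration with inner products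
`t_1 < ⋯ < t_m` one takes `D = 2m` and `v = (1+t_1, …, 1+t_m, 1+t_1, …, 1+t_m)`, the doubled node
sequence of the Hermite interpolation of Cohn–Kumar 2007, §6). Put
`ω_j(u) = ∏_{i<j} (u - v_i)` (Newton basis). Dividing `u^k` by the `ω_j` gives the Newton
expansion `u^k = Σ_{j<D} c_j(k) ω_j(u) + r_k(u) ω_D(u)` whose coefficients `c_j(k)` (complete
homogeneous symmetric polynomials of the nodes) and remainder `r_k(u)` (`u ≥ 0`) are `≥ 0` because
every `v_i ≥ 0`; so `h_k = Σ_{j<D} c_j(k) ω_j` is the Hermite interpolant of `(1+t)^k` at the nodes,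
`h_k ≤ (1+t)^k` on `[-1, 1]` as soon as `ω_D ≥ 0` there (a square for a doubled sequence), and
`h_k` is positive definite as soon as each of the finitely many partial products `ω_j`, `j < D`, has
nonnegative Gegenbauer coefficients — which is exactly Cohn–Kumar's "conductivity" of `F²`
(loc. cit., Lemma 5.3 and §6: the partial products `∏_{i≤j}(t - t_i)` of the increasing node
sequence are positive definite, and `H(a, g₁g₂) = H(a,g₁) + g₁ H(Q(a,g₁), g₂)`). With the design
identities `N·G_{j,0} = ω_j(2) + Σ_i m_i ω_j(v_i)` (the configuration is a spherical `(D-1)`-design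
with distance distribution `m_i` at `u = v_i`) the LP bound of Yudin / Cohn–Kumar Prop. 4.1
(`Literature.Geometry.DiscreteGeometry.EnergyLP.energy_ge_inner`) evaluates to the configuration's
own energy `N Σ_i m_i v_i^k`, for EVERY `k : ℕ` — `NewtonCert.energy_ge`. Summing against
nonnegative coefficients gives the same for every potential `a(t) = Σ_k c_k (1+t)^k`, `c_k ≥ 0`
(`NewtonCert.energy_ge_series`); by S. Bernstein's theorem these are precisely the absolutely
monotonic functions on `[-1,1)` of Cohn–Kumar's Theorem 1.2 (that classical identification is not
formalised here).

## References
* H. Cohn, A. Kumar, *Universally optimal distribution of points on spheres*, J. Amer. Math. Soc.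
  20 (2007) 99–148, Thm. 1.2, Prop. 4.1, §§5–6. [`CohnKumar2006`]
* V. A. Yudin, Discrete Math. Appl. 3 (1993) 75–81. [`Yudin1993`]
-/

noncomputable section

namespace Summit.Ventures.PackingBounds.Energy

open Finset Literature.Analysis.SpecialFunctions Literature.Geometry.DiscreteGeometry

namespace NewtonCert

variable (v : ℕ → ℝ)

/-- `ω_{j+1}(u) = ω_j(u) (u - v_j)` for the Newton basis `ω_j(u) = ∏_{i<j} (u - v_i)`. [folklore] -/
theorem omega_succ (j : ℕ) (u : ℝ) :
    ∏ i ∈ range (j + 1), (u - v i) = (∏ i ∈ range j, (u - v i)) * (u - v j) := by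
  rw [Finset.prod_range_succ]

/-- `ω_D` vanishes at each of its nodes. [folklore] -/
theorem omega_node {D i : ℕ} (hi : i < D) : ∏ i' ∈ range D, (v i - v i') = 0 :=
  Finset.prod_eq_zero (Finset.mem_range.2 hi) (sub_self _)

/-- One multiplication by `u` in the Newton basis: if `p = Σ_{j<D} c_j ω_j + r ω_D` then
`p·u = Σ_{j<D} (v_j c_j + c_{j-1}) ω_j + (c_{D-1} + u r) ω_D`. [folklore] -/
theorem newton_step (D : ℕ) (hD : 1 ≤ D) (c : ℕ → ℝ) (r u : ℝ) :
    (∑ j ∈ range D, c j * ∏ i ∈ range j, (u - v i) + r * ∏ i ∈ range D, (u - v i)) * u =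
      ∑ j ∈ range D, (v j * c j + if j = 0 then 0 else c (j - 1)) * ∏ i ∈ range j, (u - v i) +
        (c (D - 1) + u * r) * ∏ i ∈ range D, (u - v i) := by
  obtain ⟨E, rfl⟩ : ∃ E, D = E + 1 := ⟨D - 1, (Nat.sub_add_cancel hD).symm⟩
  have hshift : ∑ j ∈ range (E + 1), c j * ∏ i ∈ range (j + 1), (u - v i) =
      ∑ j ∈ range (E + 1), (if j = 0 then 0 else c (j - 1)) * ∏ i ∈ range j, (u - v i) +
        c E * ∏ i ∈ range (E + 1), (u - v i) := by
    rw [Finset.sum_range_succ, Finset.sum_range_succ' (fun j => (if j = 0 then 0 else c (j - 1)) *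
      ∏ i ∈ range j, (u - v i))]
    simp
  have hmul : ∀ j, c j * (∏ i ∈ range j, (u - v i)) * u =
      c j * ∏ i ∈ range (j + 1), (u - v i) + v j * c j * ∏ i ∈ range j, (u - v i) := by
    intro j; rw [omega_succ]; ring
  calc (∑ j ∈ range (E + 1), c j * ∏ i ∈ range j, (u - v i) +
          r * ∏ i ∈ range (E + 1), (u - v i)) * u
        = ∑ j ∈ range (E + 1), c j * (∏ i ∈ range j, (u - v i)) * u +
            u * r * ∏ i ∈ range (E + 1), (u - v i) := by
          rw [add_mul, Finset.sum_mul]; ring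
    _ = ∑ j ∈ range (E + 1), c j * ∏ i ∈ range (j + 1), (u - v i) +
          ∑ j ∈ range (E + 1), v j * c j * ∏ i ∈ range j, (u - v i) +
            u * r * ∏ i ∈ range (E + 1), (u - v i) := by
          rw [Finset.sum_congr rfl fun j _ => hmul j, Finset.sum_add_distrib]
    _ = _ := by
          rw [hshift, show E + 1 - 1 = E from rfl]
          have hsplit : ∑ j ∈ range (E + 1), (v j * c j + if j = 0 then 0 else c (j - 1)) *
              ∏ i ∈ range j, (u - v i) = ∑ j ∈ range (E + 1), v j * c j * ∏ i ∈ range j, (u - v i) +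
              ∑ j ∈ range (E + 1), (if j = 0 then 0 else c (j - 1)) * ∏ i ∈ range j, (u - v i) := by
            rw [← Finset.sum_add_distrib]
            exact Finset.sum_congr rfl fun j _ => by ring
          rw [hsplit]
          ring

/-- For a doubled node sequence (`v_{m+i} = v_i`, `i < m`) the top Newton polynomial is a square:
`ω_{2m}(u) = (∏_{i<m} (u - v_i))² ≥ 0`. [folklore] -/
theorem omega_doubled_nonneg (m : ℕ) (hper : ∀ i < m, v (m + i) = v i) (u : ℝ) :
    0 ≤ ∏ i ∈ range (m + m), (u - v i) := by
  have h2 : ∏ i ∈ range m, (u - v (m + i)) = ∏ i ∈ range m, (u - v i) :=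
    Finset.prod_congr rfl fun i hi => by rw [hper i (Finset.mem_range.1 hi)]
  rw [Finset.prod_range_add, h2, ← sq]
  exact sq_nonneg _

/-- **Newton expansion of `u^k` with nonnegative data.** If all nodes `v_i ≥ 0` and `D ≥ 1`, then for
every `k` there are coefficients `c_j ≥ 0` and a remainder `r(u) ≥ 0` (`u ≥ 0`) with
`u^k = Σ_{j<D} c_j ω_j(u) + r(u) ω_D(u)` for all `u` (`c_j` = complete homogeneous symmetric
polynomials of the nodes, `r` likewise with `u` adjoined). [folklore] -/
theorem newton_exists (hv : ∀ i, 0 ≤ v i) (D : ℕ) (hD : 1 ≤ D) :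
    ∀ k : ℕ, ∃ c : ℕ → ℝ, ∃ r : ℝ → ℝ, (∀ j, 0 ≤ c j) ∧ (∀ u, 0 ≤ u → 0 ≤ r u) ∧
      ∀ u : ℝ, u ^ k = ∑ j ∈ range D, c j * ∏ i ∈ range j, (u - v i) +
        r u * ∏ i ∈ range D, (u - v i) := by
  intro k
  induction k with
  | zero =>
    refine ⟨fun j => if j = 0 then 1 else 0, fun _ => 0, fun j => ?_, fun _ _ => le_rfl, fun u => ?_⟩
    · dsimp only; split_ifs <;> norm_num
    · simp only [pow_zero, ite_mul, one_mul, zero_mul, Finset.sum_ite_eq', Finset.mem_range,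
        add_zero]
      rw [if_pos (by omega), Finset.prod_range_zero]
  | succ k ih =>
    obtain ⟨c, r, hc, hr, hexp⟩ := ih
    refine ⟨fun j => v j * c j + if j = 0 then 0 else c (j - 1), fun u => c (D - 1) + u * r u,
      fun j => ?_, fun u hu => add_nonneg (hc _) (mul_nonneg hu (hr u hu)), fun u => ?_⟩
    · dsimp only
      refine add_nonneg (mul_nonneg (hv j) (hc j)) ?_
      split_ifs
      · exact le_rfl
      · exact hc _
    · rw [pow_succ, hexp u, newton_step v D hD c (r u) u]

open scoped Classical in
/-- **LP lower bound for the `(1 + ⟨x,y⟩)^k`-energy from a Newton-form certificate** (the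
Cohn–Kumar conductivity argument, all `k` at once). Data: `n = 2μ + 2`, `μ > 0`; node values
`v_i ≥ 0` (`i < D`, in `u = 1 + t`) with `ω_D ≥ 0` on `u ≥ 0`; a matrix `G ≥ 0` with
`ω_j(1+t) = Σ_{i<D} G_{j,i} C_i^{μ}(t)` for `j < D` (positive definiteness of the partial products);
`N` and a distance distribution `m_i` at the nodes `v_i`, `i < M ≤ D`, satisfying the design
identities `N G_{j,0} = ω_j(2) + Σ_{i<M} m_i ω_j(v_i)` (`j < D`). Then every `N`-point
configuration `C ⊂ S^{n-1}` has `Σ_{x ≠ y ∈ C} (1 + ⟨x,y⟩)^k ≥ N Σ_{i<M} m_i v_i^k` for every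
`k : ℕ` — the right-hand side being the `(1+t)^k`-energy of a configuration with that distance
distribution. [cite: CohnKumar2006, Theorem 1.2, Proposition 4.1 and §§5–6] -/
theorem energy_ge {n : ℕ} {μ : ℝ} (hn : (n : ℝ) = 2 * μ + 2) (hμ : 0 < μ)
    (D : ℕ) (hD : 1 ≤ D) (v : ℕ → ℝ) (hv : ∀ i, 0 ≤ v i)
    (hωD : ∀ u : ℝ, 0 ≤ u → 0 ≤ ∏ i ∈ range D, (u - v i))
    (G : ℕ → ℕ → ℝ) (hG : ∀ j i, 0 ≤ G j i)
    (hGid : ∀ j < D, ∀ t : ℝ,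
      ∏ i ∈ range j, (1 + t - v i) = ∑ i ∈ range D, G j i * gegenbauerSum μ i t)
    (N M : ℕ) (hM : M ≤ D) (mult : ℕ → ℝ)
    (hdesign : ∀ j < D, (N : ℝ) * G j 0 =
      ∏ i ∈ range j, (2 - v i) + ∑ i ∈ range M, mult i * ∏ i' ∈ range j, (v i - v i'))
    (k : ℕ) (C : Finset (EuclideanSpace ℝ (Fin n))) (h1 : ∀ x ∈ C, ‖x‖ = 1) (hN : C.card = N) :
    (N : ℝ) * ∑ i ∈ range M, mult i * v i ^ k ≤
      ∑ x ∈ C, ∑ y ∈ C.erase x, (1 + inner ℝ x y) ^ k := by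
  obtain ⟨c, r, hc, hr, hexp⟩ := newton_exists v hv D hD k
  -- Gegenbauer coefficients of the certificate `h_k = Σ_j c_j ω_j(1+t)`
  set α : ℕ → ℝ := fun i => ∑ j ∈ range D, c j * G j i with hαdef
  have hα : ∀ i, 0 ≤ α i := fun i =>
    Finset.sum_nonneg fun j _ => mul_nonneg (hc j) (hG j i)
  -- `Σ_i α_i C_i(t) = h_k(t)`
  have hswap : ∀ t : ℝ, ∑ i ∈ range D, α i * gegenbauerSum μ i t =
      ∑ j ∈ range D, c j * ∏ i ∈ range j, (1 + t - v i) := by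
    intro t
    calc ∑ i ∈ range D, α i * gegenbauerSum μ i t
          = ∑ i ∈ range D, ∑ j ∈ range D, c j * G j i * gegenbauerSum μ i t := by
            refine Finset.sum_congr rfl fun i _ => ?_
            rw [hαdef, Finset.sum_mul]
      _ = ∑ j ∈ range D, ∑ i ∈ range D, c j * G j i * gegenbauerSum μ i t :=
            Finset.sum_comm
      _ = ∑ j ∈ range D, c j * ∏ i ∈ range j, (1 + t - v i) := by
            refine Finset.sum_congr rfl fun j hj => ?_
            rw [hGid j (Finset.mem_range.1 hj) t, Finset.mul_sum]
            exact Finset.sum_congr rfl fun i _ => by ring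
  have hD' : D - 1 + 1 = D := Nat.sub_add_cancel hD
  have hH : ∀ t : ℝ, -1 ≤ t → t < 1 →
      ∑ i ∈ range (D - 1 + 1), α i * gegenbauerSum μ i t ≤ (fun t : ℝ => (1 + t) ^ k) t := by
    intro t ht _
    rw [hD', hswap t]
    have hu : (0 : ℝ) ≤ 1 + t := by linarith
    dsimp only
    rw [hexp (1 + t)]
    exact le_add_of_nonneg_right (mul_nonneg (hr _ hu) (hωD _ hu))
  have key := EnergyLP.energy_ge_inner hn hμ (D - 1) α hα (fun t : ℝ => (1 + t) ^ k) hH C h1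
  have h2 : ∑ j ∈ range D, c j * ∏ i ∈ range j, (1 + 1 - v i) =
      ∑ j ∈ range D, c j * ∏ i ∈ range j, ((2 : ℝ) - v i) :=
    Finset.sum_congr rfl fun j _ => by
      rw [Finset.prod_congr rfl fun i _ => by rw [show (1 : ℝ) + 1 = 2 by norm_num]]
  have hα0 : α 0 = ∑ j ∈ range D, c j * G j 0 := by rw [hαdef]
  rw [hD', hN, hswap 1, h2, hα0] at key
  refine le_trans (le_of_eq ?_) key
  -- evaluate the bound: `N² α_0 - N h_k(1) = N Σ_i m_i v_i^k`
  have hval : ∀ j ∈ range D, (N : ℝ) * G j 0 - ∏ i ∈ range j, (2 - v i) =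
      ∑ i ∈ range M, mult i * ∏ i' ∈ range j, (v i - v i') := fun j hj => by
    rw [hdesign j (Finset.mem_range.1 hj)]; ring
  have hnode : ∀ i ∈ range M, ∑ j ∈ range D, c j * ∏ i' ∈ range j, (v i - v i') = v i ^ k := by
    intro i hi
    have h := hexp (v i)
    rw [omega_node v (lt_of_lt_of_le (Finset.mem_range.1 hi) hM), mul_zero, add_zero] at h
    exact h.symm
  calc (N : ℝ) * ∑ i ∈ range M, mult i * v i ^ k
        = (N : ℝ) * ∑ i ∈ range M, mult i *
            ∑ j ∈ range D, c j * ∏ i' ∈ range j, (v i - v i') := by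
          congr 1; exact Finset.sum_congr rfl fun i hi => by rw [hnode i hi]
    _ = (N : ℝ) * ∑ j ∈ range D, c j *
            ∑ i ∈ range M, mult i * ∏ i' ∈ range j, (v i - v i') := by
          congr 1
          rw [Finset.sum_congr rfl fun i _ => Finset.mul_sum (range D) _ (mult i), Finset.sum_comm]
          refine Finset.sum_congr rfl fun j _ => ?_
          rw [Finset.mul_sum]
          exact Finset.sum_congr rfl fun i _ => by ring
    _ = (N : ℝ) * ∑ j ∈ range D, c j * ((N : ℝ) * G j 0 - ∏ i ∈ range j, (2 - v i)) := by
          congr 1; exact Finset.sum_congr rfl fun j hj => by rw [hval j hj]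
    _ = (N : ℝ) ^ 2 * ∑ j ∈ range D, c j * G j 0 -
          (N : ℝ) * ∑ j ∈ range D, c j * ∏ i ∈ range j, (2 - v i) := by
          rw [Finset.mul_sum, Finset.mul_sum, Finset.mul_sum, ← Finset.sum_sub_distrib]
          exact Finset.sum_congr rfl fun j _ => by ring

/-- Distinct unit vectors have inner product in `[-1, 1)`. [folklore] -/
theorem inner_mem_Ico_of_norm_eq_one {n : ℕ} {x y : EuclideanSpace ℝ (Fin n)} (hx : ‖x‖ = 1)
    (hy : ‖y‖ = 1) (hne : x ≠ y) : -1 ≤ inner ℝ x y ∧ inner ℝ x y < 1 := by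
  constructor
  · have h := abs_real_inner_le_norm x y
    rw [hx, hy, one_mul] at h
    exact (abs_le.1 h).1
  · have hsq : ‖x - y‖ ^ 2 = 2 - 2 * inner ℝ x y := by
      rw [@norm_sub_sq_real, hx, hy]; ring
    have hpos : 0 < ‖x - y‖ ^ 2 := by
      have : 0 < ‖x - y‖ := norm_pos_iff.2 (sub_ne_zero.2 hne)
      positivity
    linarith

open scoped Classical in
/-- **Universal optimality from a Newton-form certificate, power-series form.** Under the
hypotheses of `NewtonCert.energy_ge` (plus `v_i < 2` for the listed nodes, i.e. inner products
`< 1`), for every potential `a(t) = Σ_k c_k (1+t)^k` with `c_k ≥ 0` converging on `[-1,1)`, every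
`N`-point configuration `C ⊂ S^{n-1}` has `Σ_{x ≠ y ∈ C} a(⟨x,y⟩) ≥ N Σ_{i<M} m_i a(v_i - 1)` — the
`a`-energy of a configuration with distance distribution `m_i` at inner product `v_i - 1`.  By
S. Bernstein's theorem the functions `a` of this form are exactly the absolutely monotonic
functions on `[-1,1)`, so this is Cohn–Kumar's universal optimality (Thm. 1.2) for the
configuration, in LP-certificate form; Bernstein's identification itself is not formalised here.
[cite: CohnKumar2006, Theorem 1.2, Proposition 4.1 and §§5–6] -/
theorem energy_ge_series {n : ℕ} {μ : ℝ} (hn : (n : ℝ) = 2 * μ + 2) (hμ : 0 < μ)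
    (D : ℕ) (hD : 1 ≤ D) (v : ℕ → ℝ) (hv : ∀ i, 0 ≤ v i)
    (hωD : ∀ u : ℝ, 0 ≤ u → 0 ≤ ∏ i ∈ range D, (u - v i))
    (G : ℕ → ℕ → ℝ) (hG : ∀ j i, 0 ≤ G j i)
    (hGid : ∀ j < D, ∀ t : ℝ,
      ∏ i ∈ range j, (1 + t - v i) = ∑ i ∈ range D, G j i * gegenbauerSum μ i t)
    (N M : ℕ) (hM : M ≤ D) (mult : ℕ → ℝ)
    (hdesign : ∀ j < D, (N : ℝ) * G j 0 =
      ∏ i ∈ range j, (2 - v i) + ∑ i ∈ range M, mult i * ∏ i' ∈ range j, (v i - v i'))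
    (hv2 : ∀ i < M, v i < 2)
    (c : ℕ → ℝ) (hc : ∀ k, 0 ≤ c k)
    (hsum : ∀ t : ℝ, -1 ≤ t → t < 1 → Summable (fun k => c k * (1 + t) ^ k))
    (C : Finset (EuclideanSpace ℝ (Fin n))) (h1 : ∀ x ∈ C, ‖x‖ = 1) (hN : C.card = N) :
    (N : ℝ) * ∑ i ∈ range M, mult i * (∑' k, c k * v i ^ k) ≤
      ∑ x ∈ C, ∑ y ∈ C.erase x, ∑' k, c k * (1 + inner ℝ x y) ^ k := by
  -- summability at the nodes and at the inner products of `C`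
  have hsv : ∀ i ∈ range M, Summable (fun k => c k * v i ^ k) := by
    intro i hi
    have h := hsum (v i - 1) (by linarith [hv i]) (by linarith [hv2 i (Finset.mem_range.1 hi)])
    simpa only [add_sub_cancel] using h
  have hsC : ∀ x ∈ C, ∀ y ∈ C.erase x, Summable (fun k => c k * (1 + inner ℝ x y) ^ k) := by
    intro x hx y hy
    have hb := inner_mem_Ico_of_norm_eq_one (h1 x hx) (h1 y (Finset.mem_of_mem_erase hy))
      (Finset.ne_of_mem_erase hy).symm
    exact hsum _ hb.1 hb.2
  have hR : ∑ x ∈ C, ∑ y ∈ C.erase x, ∑' k, c k * (1 + inner ℝ x y) ^ k =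
      ∑' k, ∑ x ∈ C, ∑ y ∈ C.erase x, c k * (1 + inner ℝ x y) ^ k := by
    rw [Summable.tsum_finsetSum (fun x hx => summable_sum (fun y hy => hsC x hx y hy))]
    refine Finset.sum_congr rfl fun x hx => ?_
    rw [Summable.tsum_finsetSum (fun y hy => hsC x hx y hy)]
  have hL : (N : ℝ) * ∑ i ∈ range M, mult i * (∑' k, c k * v i ^ k) =
      ∑' k, (N : ℝ) * ∑ i ∈ range M, mult i * (c k * v i ^ k) := by
    rw [Summable.tsum_mul_left (N : ℝ) (summable_sum fun i hi => (hsv i hi).mul_left (mult i))]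
    congr 1
    rw [Summable.tsum_finsetSum (fun i hi => (hsv i hi).mul_left (mult i))]
    refine Finset.sum_congr rfl fun i hi => ?_
    rw [Summable.tsum_mul_left (mult i) (hsv i hi)]
  rw [hR, hL]
  refine Summable.tsum_le_tsum (fun k => ?_)
    ((summable_sum fun i hi => (hsv i hi).mul_left (mult i)).mul_left (N : ℝ))
    (summable_sum fun x hx => summable_sum fun y hy => hsC x hx y hy)
  have hk := energy_ge hn hμ D hD v hv hωD G hG hGid N M hM mult hdesign k C h1 hN
  calc (N : ℝ) * ∑ i ∈ range M, mult i * (c k * v i ^ k)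
        = c k * ((N : ℝ) * ∑ i ∈ range M, mult i * v i ^ k) := by
          rw [Finset.mul_sum, Finset.mul_sum, Finset.mul_sum]
          exact Finset.sum_congr rfl fun i _ => by ring
    _ ≤ c k * ∑ x ∈ C, ∑ y ∈ C.erase x, (1 + inner ℝ x y) ^ k :=
          mul_le_mul_of_nonneg_left hk (hc k)
    _ = ∑ x ∈ C, ∑ y ∈ C.erase x, c k * (1 + inner ℝ x y) ^ k := by
          rw [Finset.mul_sum]
          exact Finset.sum_congr rfl fun x _ => by rw [Finset.mul_sum]

open scoped Classical in
/-- **Universal optimality from a Newton-form certificate, `HasSum` form**: as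
`NewtonCert.energy_ge_series`, for a potential `a : ℝ → ℝ` that is represented on `[-1,1)` by a
power series `a(t) = Σ_k c_k (1+t)^k` with `c_k ≥ 0` (S. Bernstein: equivalently, `a` is absolutely
monotonic on `[-1,1)`): `Σ_{x ≠ y ∈ C} a(⟨x,y⟩) ≥ N Σ_{i<M} m_i a(v_i - 1)`.
[cite: CohnKumar2006, Theorem 1.2, Proposition 4.1 and §§5–6] -/
theorem energy_ge_of_hasSum {n : ℕ} {μ : ℝ} (hn : (n : ℝ) = 2 * μ + 2) (hμ : 0 < μ)
    (D : ℕ) (hD : 1 ≤ D) (v : ℕ → ℝ) (hv : ∀ i, 0 ≤ v i)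
    (hωD : ∀ u : ℝ, 0 ≤ u → 0 ≤ ∏ i ∈ range D, (u - v i))
    (G : ℕ → ℕ → ℝ) (hG : ∀ j i, 0 ≤ G j i)
    (hGid : ∀ j < D, ∀ t : ℝ,
      ∏ i ∈ range j, (1 + t - v i) = ∑ i ∈ range D, G j i * gegenbauerSum μ i t)
    (N M : ℕ) (hM : M ≤ D) (mult : ℕ → ℝ)
    (hdesign : ∀ j < D, (N : ℝ) * G j 0 =
      ∏ i ∈ range j, (2 - v i) + ∑ i ∈ range M, mult i * ∏ i' ∈ range j, (v i - v i'))
    (hv2 : ∀ i < M, v i < 2)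
    (a : ℝ → ℝ) (c : ℕ → ℝ) (hc : ∀ k, 0 ≤ c k)
    (ha : ∀ t : ℝ, -1 ≤ t → t < 1 → HasSum (fun k => c k * (1 + t) ^ k) (a t))
    (C : Finset (EuclideanSpace ℝ (Fin n))) (h1 : ∀ x ∈ C, ‖x‖ = 1) (hN : C.card = N) :
    (N : ℝ) * ∑ i ∈ range M, mult i * a (v i - 1) ≤
      ∑ x ∈ C, ∑ y ∈ C.erase x, a (inner ℝ x y) := by
  have key := energy_ge_series hn hμ D hD v hv hωD G hG hGid N M hM mult hdesign hv2 c hc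
    (fun t ht ht' => (ha t ht ht').summable) C h1 hN
  have hLa : ∀ i ∈ range M, a (v i - 1) = ∑' k, c k * v i ^ k := by
    intro i hi
    have h := (ha (v i - 1) (by linarith [hv i]) (by linarith [hv2 i (Finset.mem_range.1 hi)])).tsum_eq
    simp only [add_sub_cancel] at h
    exact h.symm
  have hRa : ∀ x ∈ C, ∀ y ∈ C.erase x, a (inner ℝ x y) = ∑' k, c k * (1 + inner ℝ x y) ^ k := by
    intro x hx y hy
    have hb := inner_mem_Ico_of_norm_eq_one (h1 x hx) (h1 y (Finset.mem_of_mem_erase hy))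
      (Finset.ne_of_mem_erase hy).symm
    exact ((ha _ hb.1 hb.2).tsum_eq).symm
  rw [Finset.sum_congr rfl fun i hi => by rw [hLa i hi],
    Finset.sum_congr rfl fun x hx => Finset.sum_congr rfl fun y hy => hRa x hx y hy]
  exact key

open scoped Classical in
/-- **Power-series form from the all-`k` form.** If for every `k` the `(1 + ⟨x,y⟩)^k`-energy of `C`
is at least `N Σ_{i<M} m_i (1 + t_i)^k` for nodes `t_i ∈ [-1,1)`, then for every potential
represented on `[-1,1)` by `a(s) = Σ_k c_k (1+s)^k` with `c_k ≥ 0` (≡ absolutely monotonic on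
`[-1,1)`, S. Bernstein) the `a`-energy of `C` is at least `N Σ_{i<M} m_i a(t_i)`: summation of the
hypothesis against the nonnegative coefficients. [folklore] -/
theorem energy_ge_hasSum_of_pow {n : ℕ} (N M : ℕ) (t : ℕ → ℝ) (mult : ℕ → ℝ)
    (ht : ∀ i < M, -1 ≤ t i ∧ t i < 1)
    (C : Finset (EuclideanSpace ℝ (Fin n))) (h1 : ∀ x ∈ C, ‖x‖ = 1)
    (hA : ∀ k : ℕ, (N : ℝ) * ∑ i ∈ range M, mult i * (1 + t i) ^ k ≤
      ∑ x ∈ C, ∑ y ∈ C.erase x, (1 + inner ℝ x y) ^ k)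
    (a : ℝ → ℝ) (c : ℕ → ℝ) (hc : ∀ k, 0 ≤ c k)
    (ha : ∀ s : ℝ, -1 ≤ s → s < 1 → HasSum (fun k => c k * (1 + s) ^ k) (a s)) :
    (N : ℝ) * ∑ i ∈ range M, mult i * a (t i) ≤ ∑ x ∈ C, ∑ y ∈ C.erase x, a (inner ℝ x y) := by
  -- summability at the nodes and at the inner products of `C`
  have hsv : ∀ i ∈ range M, HasSum (fun k => c k * (1 + t i) ^ k) (a (t i)) := fun i hi =>
    ha (t i) (ht i (Finset.mem_range.1 hi)).1 (ht i (Finset.mem_range.1 hi)).2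
  have hsC : ∀ x ∈ C, ∀ y ∈ C.erase x,
      HasSum (fun k => c k * (1 + inner ℝ x y) ^ k) (a (inner ℝ x y)) := by
    intro x hx y hy
    have hb := inner_mem_Ico_of_norm_eq_one (h1 x hx) (h1 y (Finset.mem_of_mem_erase hy))
      (Finset.ne_of_mem_erase hy).symm
    exact ha _ hb.1 hb.2
  have hR : ∑ x ∈ C, ∑ y ∈ C.erase x, a (inner ℝ x y) =
      ∑' k, ∑ x ∈ C, ∑ y ∈ C.erase x, c k * (1 + inner ℝ x y) ^ k := by
    rw [Summable.tsum_finsetSum (fun x hx => summable_sum (fun y hy => (hsC x hx y hy).summable))]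
    refine Finset.sum_congr rfl fun x hx => ?_
    rw [Summable.tsum_finsetSum (fun y hy => (hsC x hx y hy).summable)]
    exact Finset.sum_congr rfl fun y hy => ((hsC x hx y hy).tsum_eq).symm
  have hL : (N : ℝ) * ∑ i ∈ range M, mult i * a (t i) =
      ∑' k, (N : ℝ) * ∑ i ∈ range M, mult i * (c k * (1 + t i) ^ k) := by
    rw [Summable.tsum_mul_left (N : ℝ)
      (summable_sum fun i hi => ((hsv i hi).summable).mul_left (mult i))]
    congr 1
    rw [Summable.tsum_finsetSum (fun i hi => ((hsv i hi).summable).mul_left (mult i))]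
    refine Finset.sum_congr rfl fun i hi => ?_
    rw [Summable.tsum_mul_left (mult i) (hsv i hi).summable, (hsv i hi).tsum_eq]
  rw [hR, hL]
  refine Summable.tsum_le_tsum (fun k => ?_)
    ((summable_sum fun i hi => ((hsv i hi).summable).mul_left (mult i)).mul_left (N : ℝ))
    (summable_sum fun x hx => summable_sum fun y hy => (hsC x hx y hy).summable)
  calc (N : ℝ) * ∑ i ∈ range M, mult i * (c k * (1 + t i) ^ k)
        = c k * ((N : ℝ) * ∑ i ∈ range M, mult i * (1 + t i) ^ k) := by
          rw [Finset.mul_sum, Finset.mul_sum, Finset.mul_sum]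
          exact Finset.sum_congr rfl fun i _ => by ring
    _ ≤ c k * ∑ x ∈ C, ∑ y ∈ C.erase x, (1 + inner ℝ x y) ^ k :=
          mul_le_mul_of_nonneg_left (hA k) (hc k)
    _ = ∑ x ∈ C, ∑ y ∈ C.erase x, c k * (1 + inner ℝ x y) ^ k := by
          rw [Finset.mul_sum]
          exact Finset.sum_congr rfl fun x _ => by rw [Finset.mul_sum]

end NewtonCert

end Summit.Ventures.PackingBounds.Energy

end
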